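import Mathlib
import Summits.Ventures.PercRepro2.SkeletonMarks

/-!
# The unmarked region of `a₃` is monotone along the reduction relation; the one-branch and
no-branch class theorems localised to it (blind cell PercRepro2, night-1 g17; NIGHT1-G17.md §1)

The class theorems `HMF_of_one_branch` / `HMF_of_card_nzNbr_le_two` (SkeletonOneBranch.lean,
SkeletonMarks.lean) bound the nonzero neighbours of EVERY unmarked vertex.  Only the vertices that
the third mark can reach without crossing a mark matter:

* **`UAdj p ends o a₁ a₂ a₃ b x y`** — a nonzero edge `{x, y}` with `y` unmarked;
  **`InRegion … y`** — `y` is reachable from `a₃` by a walk of nonzero edges all of whose vertices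
  after `a₃` are unmarked (the *unmarked region* of `a₃`);
* **`inRegion_of_step` / `inRegion_of_reduces`** — the region never grows along a skeleton move
  (re-routing keeps the nonzero edges; zeroing and merging only remove them; the series contraction
  at an unmarked `v` replaces the walk `w – v – w'` by the edge `{w, w'}`);
* **`HMF_of_one_branch_region`** / **`HCov_of_one_branch_region`**: `u` unmarked, every OTHER vertex
  of the unmarked region of `a₃` with at most two nonzero neighbours, `a₃` with at most one ⊢ (HMF);
* **`HMF_of_region_nbr_le_two`** / **`HCov_of_region_nbr_le_two`**: every vertex of the unmarked
  region of `a₃` with at most two nonzero neighbours, no condition on `a₃` ⊢ (HMF).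

Everything behind a mark is arbitrary: the graph on the far side of `o`, `a₁`, `a₂`, `b` may carry
any number of unmarked branch vertices.  Own code; standard axioms.
-/

open scoped Classical

namespace Summit.Ventures.PercRepro2

open UnionCluster CovForm

namespace Skeleton

section RegionDefs

variable {V : Type*} {E : Type*} {R : Type*} [Field R]

/-- One step of the unmarked walk: a nonzero edge `{x, y}` whose far end `y` is unmarked. -/
def UAdj (p : E → R) (ends : E → Sym2 V) (o a₁ a₂ a₃ b : V) (x y : V) : Prop :=
  (∃ e, p e ≠ 0 ∧ ends e = s(x, y)) ∧ y ≠ o ∧ y ≠ a₁ ∧ y ≠ a₂ ∧ y ≠ a₃ ∧ y ≠ b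

/-- **The unmarked region of `a₃`**: the vertices reachable from `a₃` by a walk of nonzero edges all
of whose vertices after `a₃` are unmarked. -/
def InRegion (p : E → R) (ends : E → Sym2 V) (o a₁ a₂ a₃ b : V) (y : V) : Prop :=
  Relation.TransGen (UAdj p ends o a₁ a₂ a₃ b) a₃ y

/-- A vertex of the unmarked region is unmarked. -/
lemma unmarked_of_inRegion {p : E → R} {ends : E → Sym2 V} {o a₁ a₂ a₃ b y : V}
    (h : InRegion p ends o a₁ a₂ a₃ b y) : y ≠ o ∧ y ≠ a₁ ∧ y ≠ a₂ ∧ y ≠ a₃ ∧ y ≠ b := by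
  cases h with
  | single hxy => exact hxy.2
  | tail _ hxy => exact hxy.2

/-- The unmarked far end of a nonzero edge at `a₃` lies in the region. -/
lemma inRegion_of_edge {p : E → R} {ends : E → Sym2 V} {o a₁ a₂ a₃ b y : V} {f : E}
    (hf : ends f = s(a₃, y)) (hpf : p f ≠ 0) (hyo : y ≠ o) (hy1 : y ≠ a₁) (hy2 : y ≠ a₂)
    (hy3 : y ≠ a₃) (hyb : y ≠ b) : InRegion p ends o a₁ a₂ a₃ b y :=
  Relation.TransGen.single ⟨⟨f, hpf, hf⟩, hyo, hy1, hy2, hy3, hyb⟩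

/-- The unmarked far end of a nonzero edge at a vertex of the region lies in the region. -/
lemma inRegion_tail {p : E → R} {ends : E → Sym2 V} {o a₁ a₂ a₃ b x y : V} {e : E}
    (hx : InRegion p ends o a₁ a₂ a₃ b x) (he : ends e = s(x, y)) (hpe : p e ≠ 0) (hyo : y ≠ o)
    (hy1 : y ≠ a₁) (hy2 : y ≠ a₂) (hy3 : y ≠ a₃) (hyb : y ≠ b) :
    InRegion p ends o a₁ a₂ a₃ b y :=
  Relation.TransGen.tail hx ⟨⟨e, hpe, he⟩, hyo, hy1, hy2, hy3, hyb⟩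

end RegionDefs

section RegionMono

variable {V : Type*} {E : Type*} [DecidableEq E] {R : Type*} [Field R]

variable {o a₁ a₂ a₃ b : V}

/-- One unmarked step of the reduct is a nonempty unmarked walk of the instance. -/
lemma transGen_uadj_of_step {I J : (E → R) × (E → Sym2 V)} (h : Step o a₁ a₂ a₃ b I J) {x y : V}
    (hxy : UAdj J.1 J.2 o a₁ a₂ a₃ b x y) :
    Relation.TransGen (UAdj I.1 I.2 o a₁ a₂ a₃ b) x y := by
  obtain ⟨⟨e, he, hexy⟩, hyo, hy1, hy2, hy3, hyb⟩ := hxy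
  cases h with
  | @reroute p ends ends' hr =>
    dsimp only at he hexy
    exact Relation.TransGen.single ⟨⟨e, he, by dsimp only; rw [hr e he]; exact hexy⟩, hyo, hy1,
      hy2, hy3, hyb⟩
  | @loop p ends f z hf =>
    dsimp only at he hexy
    have hpe : p e ≠ 0 := by
      intro h0; apply he
      by_cases hef : e = f
      · subst hef; simp
      · rw [Function.update_of_ne hef]; exact h0
    exact Relation.TransGen.single ⟨⟨e, hpe, hexy⟩, hyo, hy1, hy2, hy3, hyb⟩
  | @leaf p ends f z z' hf hleaf hzz hzo hz1 hz2 hz3 hzb =>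
    dsimp only at he hexy
    have hpe : p e ≠ 0 := by
      intro h0; apply he
      by_cases hef : e = f
      · subst hef; simp
      · rw [Function.update_of_ne hef]; exact h0
    exact Relation.TransGen.single ⟨⟨e, hpe, hexy⟩, hyo, hy1, hy2, hy3, hyb⟩
  | @series p ends f f' v w w' hff hf hf' hdeg hvw hvw' hvo hv1 hv2 hv3 hvb =>
    dsimp only at he hexy
    by_cases hef' : e = f'
    · subst hef'; simp at he
    rw [Function.update_of_ne hef'] at he
    by_cases hef : e = f
    · subst hef
      rw [Function.update_self] at he hexy
      have hpf : p e ≠ 0 := left_ne_zero_of_mul he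
      have hpf' : p f' ≠ 0 := right_ne_zero_of_mul he
      -- the contracted edge `{w, w'}` is the walk `w – v – w'` of the instance (`v` unmarked)
      rcases Sym2.eq_iff.1 hexy with ⟨hxw, hyw'⟩ | ⟨hyw, hxw'⟩
      · subst hxw; subst hyw'
        exact Relation.TransGen.tail
          (Relation.TransGen.single ⟨⟨e, hpf, by dsimp only; rw [hf, Sym2.eq_swap]⟩, hvo.symm,
            hv1.symm, hv2.symm, hv3.symm, hvb.symm⟩)
          ⟨⟨f', hpf', hf'⟩, hyo, hy1, hy2, hy3, hyb⟩
      · subst hyw; subst hxw'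
        exact Relation.TransGen.tail
          (Relation.TransGen.single ⟨⟨f', hpf', by dsimp only; rw [hf', Sym2.eq_swap]⟩, hvo.symm,
            hv1.symm, hv2.symm, hv3.symm, hvb.symm⟩)
          ⟨⟨e, hpf, hf⟩, hyo, hy1, hy2, hy3, hyb⟩
    · rw [Function.update_of_ne hef] at he hexy
      exact Relation.TransGen.single ⟨⟨e, he, hexy⟩, hyo, hy1, hy2, hy3, hyb⟩
  | @merge p ends e₁ e₂ hne hpar =>
    dsimp only at he hexy
    by_cases he2 : e = e₂
    · subst he2; simp at he
    rw [Function.update_of_ne he2] at he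
    by_cases he1 : e = e₁
    · subst he1
      rw [Function.update_self] at he
      by_cases h2 : p e₂ = 0
      · refine Relation.TransGen.single ⟨⟨e, ?_, hexy⟩, hyo, hy1, hy2, hy3, hyb⟩
        intro h0; dsimp only at h0; apply he; rw [h0, h2]; ring
      · exact Relation.TransGen.single ⟨⟨e₂, h2, by dsimp only; rw [← hpar]; exact hexy⟩, hyo,
          hy1, hy2, hy3, hyb⟩
    · rw [Function.update_of_ne he1] at he
      exact Relation.TransGen.single ⟨⟨e, he, hexy⟩, hyo, hy1, hy2, hy3, hyb⟩

/-- **The unmarked region of `a₃` never grows under a skeleton move.** -/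
theorem inRegion_of_step {I J : (E → R) × (E → Sym2 V)} (h : Step o a₁ a₂ a₃ b I J) {y : V}
    (hy : InRegion J.1 J.2 o a₁ a₂ a₃ b y) : InRegion I.1 I.2 o a₁ a₂ a₃ b y := by
  induction hy with
  | single hxy => exact transGen_uadj_of_step h hxy
  | tail _ hxy ih => exact ih.trans (transGen_uadj_of_step h hxy)

/-- **The unmarked region of `a₃` never grows along a reduction.** -/
theorem inRegion_of_reduces {I J : (E → R) × (E → Sym2 V)} (h : Reduces o a₁ a₂ a₃ b I J) {y : V}
    (hy : InRegion J.1 J.2 o a₁ a₂ a₃ b y) : InRegion I.1 I.2 o a₁ a₂ a₃ b y := by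
  induction h with
  | refl => exact hy
  | tail _ hbc ih => exact ih (inRegion_of_step hbc hy)

end RegionMono

section RegionClasses

variable {V : Type*} {E : Type*} [Fintype E] [DecidableEq E] [Fintype V] [DecidableEq V]
  {R : Type*} [Field R] [LinearOrder R] [IsStrictOrderedRing R]

variable {o a₁ a₂ a₃ b : V}

omit [IsStrictOrderedRing R] in
/-- In a simple reduct, a vertex of the unmarked region of `a₃` whose number of nonzero neighbours
in the ORIGINAL instance is at most two carries no nonzero edge. -/
lemma notMem_of_simple_of_inRegion {p : E → R} {ends : E → Sym2 V}
    {q : E → R} {ends' : E → Sym2 V} (h : Reduces o a₁ a₂ a₃ b (p, ends) (q, ends'))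
    (hs : Simple q ends' o a₁ a₂ a₃ b) {v : V} (hv : InRegion q ends' o a₁ a₂ a₃ b v)
    (hle : (nzNbr p ends v).card ≤ 2) {e : E} (he : q e ≠ 0) (hve : v ∈ ends' e) : False := by
  obtain ⟨hvo, hv1, hv2, hv3, hvb⟩ := unmarked_of_inRegion hv
  exact notMem_of_simple_of_card_nzNbr_le_two hs hvo hv1 hv2 hv3 hvb
    (le_trans (card_nzNbr_le_of_reduces (I := (p, ends)) (J := (q, ends')) h v) hle) he hve

/-- **(HMF) with at most one unmarked branch vertex in the region of `a₃`**: `u` unmarked, every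
OTHER vertex of the unmarked region of `a₃` with at most two nonzero neighbours, `a₃` with at most
one nonzero neighbour, the five marks distinct ⊢ (HMF).  Nothing is assumed beyond the marks. -/
theorem HMF_of_one_branch_region (p : E → R) (ends : E → Sym2 V) (hp : IsProbVec p) (u : V)
    (huo : u ≠ o) (hu1 : u ≠ a₁) (hu2 : u ≠ a₂) (hu3 : u ≠ a₃) (hub : u ≠ b)
    (hinj : Function.Injective (Hub3.markOf3 o a₁ a₂ a₃ b))
    (hnbr : ∀ v, v ≠ u → InRegion p ends o a₁ a₂ a₃ b v → (nzNbr p ends v).card ≤ 2)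
    (h3 : (nzNbr p ends a₃).card ≤ 1) :
    HMF p ends o a₁ a₂ a₃ b := by
  have h31 : a₃ ≠ a₁ := hinj.ne (by decide : Hub.Mark.a₃ ≠ Hub.Mark.a₁)
  have h32 : a₃ ≠ a₂ := hinj.ne (by decide : Hub.Mark.a₃ ≠ Hub.Mark.a₂)
  have h3o : a₃ ≠ o := hinj.ne (by decide : Hub.Mark.a₃ ≠ Hub.Mark.o)
  have h3b : a₃ ≠ b := hinj.ne (by decide : Hub.Mark.a₃ ≠ Hub.Mark.b)
  obtain ⟨J, hJ, hJs⟩ := exists_reduces_simple o a₁ a₂ a₃ b p ends hp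
  obtain ⟨q, ends'⟩ := J
  -- every vertex of the region other than `u` has no nonzero edge in the reduct
  have hiso : ∀ v, v ≠ u → InRegion q ends' o a₁ a₂ a₃ b v → ∀ e, q e ≠ 0 → v ∉ ends' e := by
    intro v hvu hv e he hve
    exact notMem_of_simple_of_inRegion hJ hJs hv
      (hnbr v hvu (inRegion_of_reduces (I := (p, ends)) (J := (q, ends')) hJ hv)) he hve
  have h3' : (nzNbr q ends' a₃).card ≤ 1 :=
    le_trans (card_nzNbr_le_of_reduces (I := (p, ends)) (J := (q, ends')) hJ a₃) h3
  obtain ⟨-, hnoloop, hnopar⟩ := hJs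
  dsimp only at hnoloop hnopar
  by_cases hex : ∃ e, q e ≠ 0 ∧ a₃ ∈ ends' e
  · obtain ⟨f, hqf, haf⟩ := hex
    obtain ⟨y, hy⟩ := Sym2.mem_iff_exists.1 haf
    have hy3 : y ≠ a₃ := by
      intro hh; subst hh
      exact hnoloop f hqf (by rw [hy]; exact Sym2.mk_isDiag_iff.2 rfl)
    -- every nonzero edge at `a₃` is `f`: its far end is `y` (one neighbour), so it is parallel to `f`
    have hleaf : ∀ e, q e ≠ 0 → a₃ ∈ ends' e → e = f := by
      intro e he hae
      obtain ⟨z, hz⟩ := Sym2.mem_iff_exists.1 hae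
      have hyz : y = z := by
        by_contra hyz
        have hsub : ({y, z} : Finset V) ⊆ nzNbr q ends' a₃ := by
          intro w hw
          simp only [Finset.mem_insert, Finset.mem_singleton] at hw
          rw [mem_nzNbr]
          rcases hw with rfl | rfl
          · exact ⟨f, hqf, hy⟩
          · exact ⟨e, he, hz⟩
        have := Finset.card_le_card hsub
        rw [Finset.card_pair hyz] at this
        omega
      subst hyz
      by_contra hef
      exact hnopar e f he hqf hef (by rw [hz, hy])
    -- the far end `y` is a mark or the hub `u`
    by_cases hyu : y = u
    · subst hyu
      have hyreg : InRegion q ends' o a₁ a₂ a₃ b y := inRegion_of_edge hy hqf huo hu1 hu2 hu3 hub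
      refine HMF_of_reduces_leaf_hub hp hJ hy hqf hleaf ?_ hy3.symm h3o h31 h32 h3b hu1 hu2 huo hub
      intro e he hue
      obtain ⟨z, hz⟩ := Sym2.mem_iff_exists.1 hue
      by_cases hzu : z = y
      · exfalso; subst hzu
        exact hnoloop e he (by rw [hz]; exact Sym2.mk_isDiag_iff.2 rfl)
      by_cases hz3 : z = a₃
      · left; rw [hz, hz3]
      by_cases hz1 : z = a₁
      · right; left; rw [hz, hz1]
      by_cases hz2 : z = a₂
      · right; right; left; rw [hz, hz2]
      by_cases hzo : z = o
      · right; right; right; left; rw [hz, hzo]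
      by_cases hzb : z = b
      · right; right; right; right; left; rw [hz, hzb]
      exfalso
      exact hiso z hzu (inRegion_tail hyreg hz he hzo hz1 hz2 hz3 hzb) e he
        (by rw [hz]; exact Sym2.mem_mk_right y z)
    · by_cases hy1 : y = a₁
      · rw [hy1] at hy
        exact HMF_of_reduces_leaf_at_root1 hp hJ hy hqf hleaf h31 h32 h3o.symm h3b.symm
      by_cases hy2 : y = a₂
      · rw [hy2] at hy
        exact HMF_of_reduces_leaf_at_root2 hp hJ hy hqf hleaf h32 h31 h3o.symm h3b.symm
      by_cases hyo : y = o
      · rw [hyo] at hy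
        exact HMF_of_reduces_leaf_at_o hp hJ hy hqf hleaf h3o h31 h32 h3b.symm
      by_cases hyb : y = b
      · rw [hyb] at hy
        exact HMF_of_reduces_leaf_at_b hp hJ hy hqf hleaf h3b h31 h32 h3o.symm
      exfalso
      exact hiso y hyu (inRegion_of_edge hy hqf hyo hy1 hy2 hy3 hyb) f hqf
        (by rw [hy]; exact Sym2.mem_mk_right a₃ y)
  · -- no nonzero edge at `a₃`: the mean field is exact
    refine HMF_of_reduces_isolated hp hJ ?_ h31 h32 h3o.symm h3b.symm
    intro e he hae
    exact hex ⟨e, he, hae⟩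

/-- **(HCOV) with at most one unmarked branch vertex in the region of `a₃`.** -/
theorem HCov_of_one_branch_region (p : E → R) (ends : E → Sym2 V) (hp : IsProbVec p) (u : V)
    (huo : u ≠ o) (hu1 : u ≠ a₁) (hu2 : u ≠ a₂) (hu3 : u ≠ a₃) (hub : u ≠ b)
    (hinj : Function.Injective (Hub3.markOf3 o a₁ a₂ a₃ b))
    (hnbr : ∀ v, v ≠ u → InRegion p ends o a₁ a₂ a₃ b v → (nzNbr p ends v).card ≤ 2)
    (h3 : (nzNbr p ends a₃).card ≤ 1) :
    HCov p ends o a₁ a₂ a₃ b :=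
  HCov_of_HMF p hp ends o a₁ a₂ a₃ b
    (HMF_of_one_branch_region p ends hp u huo hu1 hu2 hu3 hub hinj hnbr h3)

/-- **(HMF) without unmarked branch vertices in the region of `a₃`, no condition on `a₃`**: if every
vertex of the unmarked region of `a₃` has at most two nonzero neighbours, (HMF) holds. -/
theorem HMF_of_region_nbr_le_two (p : E → R) (ends : E → Sym2 V) (hp : IsProbVec p)
    (h31 : a₃ ≠ a₁) (h32 : a₃ ≠ a₂) (h3o : a₃ ≠ o) (h3b : a₃ ≠ b)
    (hnbr : ∀ v, InRegion p ends o a₁ a₂ a₃ b v → (nzNbr p ends v).card ≤ 2) :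
    HMF p ends o a₁ a₂ a₃ b := by
  obtain ⟨J, hJ, hJs⟩ := exists_reduces_simple o a₁ a₂ a₃ b p ends hp
  obtain ⟨q, ends'⟩ := J
  refine HMF_of_reduces_marks_at_a3 hp hJ ?_ h31 h32 h3o h3b
  intro e he hae
  obtain ⟨y, hy⟩ := Sym2.mem_iff_exists.1 hae
  have hnoloop := hJs.2.1
  dsimp only at hnoloop
  have hy3 : y ≠ a₃ := by
    intro hh; subst hh
    exact hnoloop e he (by rw [hy]; exact Sym2.mk_isDiag_iff.2 rfl)
  by_cases hy1 : y = a₁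
  · left; rw [hy, hy1]
  by_cases hy2 : y = a₂
  · right; left; rw [hy, hy2]
  by_cases hyo : y = o
  · right; right; left; rw [hy, hyo]
  by_cases hyb : y = b
  · right; right; right; rw [hy, hyb]
  exfalso
  have hyreg : InRegion q ends' o a₁ a₂ a₃ b y := inRegion_of_edge hy he hyo hy1 hy2 hy3 hyb
  exact notMem_of_simple_of_inRegion hJ hJs hyreg
    (hnbr y (inRegion_of_reduces (I := (p, ends)) (J := (q, ends')) hJ hyreg)) he
    (by rw [hy]; exact Sym2.mem_mk_right a₃ y)

/-- **(HCOV) without unmarked branch vertices in the region of `a₃`.** -/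
theorem HCov_of_region_nbr_le_two (p : E → R) (ends : E → Sym2 V) (hp : IsProbVec p)
    (h31 : a₃ ≠ a₁) (h32 : a₃ ≠ a₂) (h3o : a₃ ≠ o) (h3b : a₃ ≠ b)
    (hnbr : ∀ v, InRegion p ends o a₁ a₂ a₃ b v → (nzNbr p ends v).card ≤ 2) :
    HCov p ends o a₁ a₂ a₃ b :=
  HCov_of_HMF p hp ends o a₁ a₂ a₃ b (HMF_of_region_nbr_le_two p ends hp h31 h32 h3o h3b hnbr)

end RegionClasses

end Skeleton

end Summit.Ventures.PercRepro2
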